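import Summits.BirchSwinnertonDyer.BirchSwinnertonDyer.Theorems.ManinLocalTwoThreeTameThreeNeronScalarIIIstar
import Literature.NumberTheory.EllipticCurves.PastenHeightBoundsLemma68Proofs
import Literature.NumberTheory.EllipticCurves.RootNumberTwistProofs
import HarnessLib

/-!
# Additive reduction at a prime `p` is a `ℚ`-isogeny invariant; so is `p² ∣ N`

Summit `BirchSwinnertonDyer`, route `ManinLocalTwoThree` (cell bsd-f2-manin), cruxes C2 `ManinOddAtFour` (stmt-…-22967) / C3
`ManinPrimeToThreeAtNine` (stmt-…-22968).  The modularity-free substitute for conductor invariance used throughout the cell's local laws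
(`…IstarZeroNeronScalarLaw` at `p = 3`), at every prime: by the local trichotomy and the transfers of good reduction (*AEC* VII.7.2, tree
`Isogeny.hasGoodReductionAt_of_hasGoodReductionAt`) and of multiplicative reduction (tree `Isogeny.hasMultiplicativeReductionAt_of_…`),

* `hasAdditiveReductionAt_placeOf_of_isIsogenous` — `W` additive at the place of `ℤ` above `p`, `W ∼ W′` ⟹ `W′` additive there;
* `two_le_conductorExponent_placeOf_of_isIsogenous`, `sq_dvd_conductorNorm_of_isIsogenous` — `p² ∣ N(W) ⟹ p² ∣ N(W′)` (`f_p ≥ 2` transfers).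

HONEST FRAMING: the full conductor is an isogeny invariant only granted Ogg–Saito / modularity in the tree; this is the additive bit.  No
definitions, no named facts, no sorry.  References: [SilvermanAEC2009] Cor. VII.7.2, VII.5.1; [SilvermanATAEC1994] IV.10.2.
-/

set_option linter.dupNamespace false
set_option autoImplicit false

noncomputable section

open scoped Classical

open WeierstrassCurve IsDedekindDomain NumberField Rat.HeightOneSpectrum
  Literature.NumberTheory.DiophantineGeometry Literature.NumberTheory.EllipticCurves
  Summit.BirchSwinnertonDyer.Rank1Residual.Additive

namespace Summit.BirchSwinnertonDyer.BirchSwinnertonDyer.Theorems.ManinLocalTwoThree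

variable {W W' : WeierstrassCurve ℚ} [W.IsElliptic] [W'.IsElliptic] (p : ℕ) [hp : Fact p.Prime]

/-- **Additive reduction at `p` is a `ℚ`-isogeny invariant.** [cite: SilvermanAEC2009, Cor. VII.7.2 and Prop. VII.5.1] -/
theorem hasAdditiveReductionAt_placeOf_of_isIsogenous (ha : W.HasAdditiveReductionAt (placeOf p)) (h : IsIsogenous W W') :
    W'.HasAdditiveReductionAt (placeOf p) := by
  set v' : HeightOneSpectrum (𝓞 ℚ) := (primesEquiv (R := 𝓞 ℚ)).symm ⟨p, hp.out⟩ with hv'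
  have haW : W.HasAdditiveReductionAt v' := (W.hasAdditiveReductionAt_int_iff_ringOfIntegers ⟨p, hp.out⟩).mp ha
  obtain ⟨ψ⟩ := h.symm_of_charZero
  obtain ⟨φ⟩ := h
  rcases hasGoodReductionAt_or_hasMultiplicativeReductionAt_or_hasAdditiveReductionAt v' W' with hg | hm | ha'
  · exact absurd (φ.hasGoodReductionAt_of_hasGoodReductionAt hg) haW.not_hasGoodReductionAt
  · exact absurd (ψ.hasMultiplicativeReductionAt_of_hasMultiplicativeReductionAt hm) haW.not_hasMultiplicativeReductionAt
  · exact (W'.hasAdditiveReductionAt_int_iff_ringOfIntegers ⟨p, hp.out⟩).mpr ha'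

/-- `f_p ≥ 2` transfers along a `ℚ`-isogeny. [cite: SilvermanATAEC1994, IV.10.2] -/
theorem two_le_conductorExponent_placeOf_of_isIsogenous (hf : 2 ≤ W.conductorExponent (placeOf p)) (h : IsIsogenous W W') :
    2 ≤ W'.conductorExponent (placeOf p) := by
  haveI : PerfectField (IsLocalRing.ResidueField ((placeOf p).adicCompletionIntegers ℚ)) := PerfectField.ofFinite
  exact (W'.two_le_conductorExponent_iff_holds (placeOf p)).mpr
    (hasAdditiveReductionAt_placeOf_of_isIsogenous p ((W.two_le_conductorExponent_iff_holds (placeOf p)).mp hf) h)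

/-- **`p² ∣ N(W) ⟹ p² ∣ N(W′)` for `W ∼ W′`.** [cite: SilvermanATAEC1994, IV.10.2] -/
theorem sq_dvd_conductorNorm_of_isIsogenous (h2 : p ^ 2 ∣ W.conductorNorm ℤ) (h : IsIsogenous W W') :
    p ^ 2 ∣ W'.conductorNorm ℤ := by
  have hN0 : W.conductorNorm ℤ ≠ 0 := (W.conductorNorm_pos_holds).ne'
  have hN0' : W'.conductorNorm ℤ ≠ 0 := (W'.conductorNorm_pos_holds).ne'
  have e : (W.conductorNorm ℤ).factorization p = W.conductorExponent (placeOf p) :=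
    factorization_conductorNorm_primesEquiv_symm W ⟨p, hp.out⟩
  have e' : (W'.conductorNorm ℤ).factorization p = W'.conductorExponent (placeOf p) :=
    factorization_conductorNorm_primesEquiv_symm W' ⟨p, hp.out⟩
  have hf : 2 ≤ W.conductorExponent (placeOf p) := by
    rw [← e]; exact (hp.out.pow_dvd_iff_le_factorization hN0).mp h2
  have hf' := two_le_conductorExponent_placeOf_of_isIsogenous p hf h
  rw [← e'] at hf'
  exact (hp.out.pow_dvd_iff_le_factorization hN0').mpr hf'

end Summit.BirchSwinnertonDyer.BirchSwinnertonDyer.Theorems.ManinLocalTwoThree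

end
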